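import Summits.QuantumAdvantage.QuantumAdvantage.Theorems.CubicForrelationNearExactIsExactTwelveWindowLevelFive
import Summits.QuantumAdvantage.QuantumAdvantage.Theorems.CubicForrelationNearExactIsExactTwelveLevelFiveTame

/-!
# Crux `CubicForrelation.NearExactIsExact` (stmt-QuantumAdvantage-14043) — n = 12: structure of a hypothetical cubic pair with `59/64 < Φ < 1`

Certificate seat `b2b-cforr-cert` (gen 13).  HONEST FRAMING: a kernel-checked STRUCTURE THEOREM (standard axioms) about cubic Boolean pairs on
12 bits.  `θ₁₂` is certified `< 953/1024` (`isolation_twelve_953`) and witnessed `≥ 57/64`; whether `θ₁₂ ≤ 59/64` is open, and this file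
says what a pair with `Φ ∈ (59/64, 1)` — equivalently `Φ ∈ {945, …, 952}/1024` — must look like.  NOT summit progress.

THEOREM `window_twelve_structure`: cubic `f, g : 𝔽₂¹² → 𝔽₂` with `59/64 < Φ(f,g) < 1`.  Then for the side `g` (and symmetrically for
`f`, second conjunct): `W_g = 32·u'` with `u'` integer-valued and odd somewhere (level exactly 5; `{u' odd}` is an affine hyperplane by
`stub_walshTower`), `u' = 2(−1)^f` wherever `u'` is even (the pair is exact off the hyperplane, `tw5_off_flat_all`), and at some point
of the hyperplane the residual `u' − 2(−1)^f` is `≡ ±3 (mod 8)` (a wild point of the odd kind; `tw5_levelFive_lt_of_tame`).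
Ingredients: `to12_window_typeE` (gen 12), `tw6_levelSix_lt`, `tw5_off_flat_all`, `tw5_levelFive_lt_of_tame` (gen 13).

References: Ax (1964) / McEliece (1972); MacWilliams–Sloane (1977) Ch. 13–15; Carlet (2021); O'Donnell (2014) §3.3.
-/

set_option linter.dupNamespace false -- D-0017: single-problem summit ⇒ `QuantumAdvantage.QuantumAdvantage` by design

noncomputable section

namespace Summit.QuantumAdvantage.QuantumAdvantage.Theorems.CubicForrelation.NearExactIsExact

open Finset
open Literature.Computability.QuantumComplexity
open Literature.Computability.QuantumComplexity.DerivativeWalsh (W)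

/-- One side of `window_twelve_structure`. [this work] -/
theorem window_twelve_structure_side (f g : (Fin (6 + 6) → Bool) → Bool) (hf : IsDegLeFun 3 f) (hg : IsDegLeFun 3 g)
    (hlo : (59 / 64 : ℝ) < forrelation f g) (hlt : forrelation f g < 1) :
    ∃ u' : (Fin (6 + 6) → Bool) → ℤ, (∀ x, W (fun y => signOf (g y)) x = 32 * (u' x : ℝ)) ∧ (∃ x, Odd (u' x)) ∧
      (∀ y, ¬ Odd (u' y) → u' y = 2 * sZ (f y)) ∧
      ∃ x, Odd (u' x) ∧ ¬ (8 : ℤ) ∣ u' x - 2 * sZ (f x) - 1 ∧ ¬ (8 : ℤ) ∣ u' x - 2 * sZ (f x) + 1 := by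
  obtain ⟨hgE, x₀, k₀, hk₀⟩ := window_twelve_levelFive_side f g hf hg hlo hlt
  choose u' hu' using hgE
  have hu'5 : ∀ x, W (fun y => signOf (g y)) x = (2 : ℝ) ^ 5 * (u' x : ℝ) := fun x => (hu' x).trans (by norm_num)
  have hodd : ∃ x, Odd (u' x) := by
    refine ⟨x₀, k₀, ?_⟩
    have h : (32 : ℝ) * (u' x₀ : ℝ) = 32 * (2 * (k₀ : ℝ) + 1) := by rw [← hu' x₀, hk₀]
    have h' : ((u' x₀ : ℤ) : ℝ) = ((2 * k₀ + 1 : ℤ) : ℝ) := by push_cast; linarith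
    exact_mod_cast h'
  refine ⟨u', hu', hodd, tw5_off_flat_all f g hf hg u' hu'5 hodd hlo, ?_⟩
  by_contra hnone
  push Not at hnone
  have htame : ∀ x, Odd (u' x) → (8 : ℤ) ∣ u' x - 2 * sZ (f x) - 1 ∨ (8 : ℤ) ∣ u' x - 2 * sZ (f x) + 1 := by
    intro x hx
    by_cases h1 : (8 : ℤ) ∣ u' x - 2 * sZ (f x) - 1
    · exact Or.inl h1
    · exact Or.inr (hnone x hx h1)
  have h := tw5_levelFive_lt_of_tame f g hf hg u' hu'5 hodd htame hlo
  linarith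

/-- **Structure of a hypothetical cubic pair on 12 bits with `59/64 < Φ < 1`**: on EACH side the spectrum is `32·u'` with `u'` odd
somewhere, the pair is exact (`u' = 2(−1)^{partner}`) off the odd hyperplane, and some point of the hyperplane is wild of the odd kind
(`u' − 2(−1)^{partner} ≡ ±3 (mod 8)`).  Structure theorem; NOT summit progress. [this work] -/
theorem window_twelve_structure (f g : (Fin (6 + 6) → Bool) → Bool) (hf : IsDegLeFun 3 f) (hg : IsDegLeFun 3 g)
    (hlo : (59 / 64 : ℝ) < forrelation f g) (hlt : forrelation f g < 1) :
    (∃ u' : (Fin (6 + 6) → Bool) → ℤ, (∀ x, W (fun y => signOf (g y)) x = 32 * (u' x : ℝ)) ∧ (∃ x, Odd (u' x)) ∧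
      (∀ y, ¬ Odd (u' y) → u' y = 2 * sZ (f y)) ∧
      ∃ x, Odd (u' x) ∧ ¬ (8 : ℤ) ∣ u' x - 2 * sZ (f x) - 1 ∧ ¬ (8 : ℤ) ∣ u' x - 2 * sZ (f x) + 1) ∧
    (∃ v' : (Fin (6 + 6) → Bool) → ℤ, (∀ x, W (fun y => signOf (f y)) x = 32 * (v' x : ℝ)) ∧ (∃ x, Odd (v' x)) ∧
      (∀ y, ¬ Odd (v' y) → v' y = 2 * sZ (g y)) ∧
      ∃ x, Odd (v' x) ∧ ¬ (8 : ℤ) ∣ v' x - 2 * sZ (g x) - 1 ∧ ¬ (8 : ℤ) ∣ v' x - 2 * sZ (g x) + 1) := by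
  refine ⟨window_twelve_structure_side f g hf hg hlo hlt, window_twelve_structure_side g f hg hf ?_ ?_⟩
  · rwa [Summit.QuantumAdvantage.QuantumAdvantage.Theorems.SignedCubicForrelationNotPrBPP.Negative.HalfQuad.forrelation_comm]
  · rwa [Summit.QuantumAdvantage.QuantumAdvantage.Theorems.SignedCubicForrelationNotPrBPP.Negative.HalfQuad.forrelation_comm]

end Summit.QuantumAdvantage.QuantumAdvantage.Theorems.CubicForrelation.NearExactIsExact

end
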